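import Summits.QuantumFields.YangMills.Theorems.EntropyBudgetEquipartitionFreeEnergyRate
import Summits.QuantumFields.YangMills.Theorems.EntropyBudgetEquipartitionBudgetRatePlane
import Summits.QuantumFields.YangMills.Theorems.WeakCouplingRatesCurrency
import HarnessLib

/-!
# Route `SourcedPressureJensen`, crux `SourcedPressureDecoupling` (stmt-QuantumFields-24028): the CENTRING WINDOW
# `|m_T| ≤ W` — crude equipartition of the torus plaquette mean, PROVED

The first conjunct of KS2′ (`SourcedPressureDecoupling`, stmt-QuantumFields-24028) asks, for `β ≥ β₂` and eventually in the
torus size `L + 1`, `|β · E_{β,L+1}[c₁₂]| ≤ W` ("crude equipartition, `m_T = β·E_T[c]`; from FreeEnergyRate stmt-22402 +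
convexity of the torus pressure in β").  Both inputs are in the tree: the PROVED crux `FreeEnergyRate`
(`Summit.QuantumFields.YangMills.Theorems.freeEnergyRate_proof`: `|f_r(β) + (3D_r/2) log β − K| ≤ Cβ^{−κ}`) and the convexity
transfer to finite tori per plane (`EntropyBudgetEquipartition.BudgetRate.budgetRate_torus_plane`).  Composing them:

* `torusMean_plaqCost_rate` — for every compact simple `G` and lattice representation `r` there are `κ > 0`, `C`, `β₁` with:
  for `β ≥ β₁`, eventually in `L`, `|β·E_{β,L+1}[plaqCost0 r.ρ 1 2] − D_r/4| ≤ C β^{−κ}`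
  (`D_r = dim_ℝ 𝔤_r`, the finrank of the span of the one-parameter generators of `range r.ρ`, as in `FreeEnergyRate`);
* `abs_torusMean_plaqCost_le` — hence the centring window: `∃ W β₂, ∀ β ≥ β₂, ∀ᶠ L, |β·E_{β,L+1}[plaqCost0 r.ρ 1 2]| ≤ W`,
  LITERALLY the first conjunct of 24028 (with `W = D_r/4 + |C|`).

Everything is proved; no definition, no named fact.  RECORD-label rung support (route target `XiPow` = an upper bound on the
lattice gap); the Yang–Mills mass gap is NOT proved by anything here. [folklore]
-/

set_option autoImplicit false

noncomputable section

open MeasureTheory Filter Topology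
open Literature.MathematicalPhysics.QuantumFieldTheory Literature.MathematicalPhysics.QuantumLattice
open Summit.QuantumFields.YangMills.Theorems.WeakCouplingRates

namespace Summit.QuantumFields.YangMills.Theorems.SourcedPressureJensen

/-- **Torus plaquette mean: equipartition with a power rate, eventually in the volume.**  For every compact simple `G` and
lattice representation `r`: `∃ κ > 0, C, β₁` such that for `β ≥ β₁`, eventually in `L`,
`|β · E_{β,L+1}[plaqCost0 r.ρ 1 2] − D_r/4| ≤ C β^{−κ}` — the proved crux `FreeEnergyRate` fed into the convexity transfer
`budgetRate_torus_plane` (plane `(1,2)`). [folklore] -/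
theorem torusMean_plaqCost_rate :
    ∀ (G : Type) [Group G] [TopologicalSpace G] [IsTopologicalGroup G] [CompactSpace G],
      IsCompactSimpleLieGroup G →
      letI : MeasurableSpace G := borel G
      haveI : BorelSpace G := ⟨rfl⟩
      ∀ r : LatticeRep G, ∃ κ C β₁ : ℝ, 0 < κ ∧ ∀ β : ℝ, β₁ ≤ β → ∀ᶠ L : ℕ in atTop,
        |β * wilsonExpectation (L := L + 1) r.ρ β (toTorusObservable (L + 1) (plaqCost0 (d := 4) r.ρ 1 2)) -
            (Module.finrank ℝ ↥(Submodule.span ℝ {X : Matrix (Fin r.N) (Fin r.N) ℂ |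
              ∀ t : ℝ, NormedSpace.exp ((t : ℂ) • X) ∈ Set.range r.ρ}) : ℝ) / 4| ≤ C * β ^ (-κ) := by
  intro G _ _ _ _ hG
  letI : MeasurableSpace G := borel G
  haveI : BorelSpace G := ⟨rfl⟩
  intro r
  obtain ⟨K, κ, C, β₀, hκ, hrate⟩ := freeEnergyRate_proof G hG r
  obtain ⟨C', β₁, h⟩ := EntropyBudgetEquipartition.BudgetRate.budgetRate_torus_plane r hκ hrate
    (i := (1 : Fin 4)) (j := (2 : Fin 4)) (by decide)
  refine ⟨κ / 2, C', β₁, by positivity, fun β hβ => ?_⟩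
  filter_upwards [h β hβ] with L hL
  exact hL

/-- **The centring window `|m_T| ≤ W` of `SourcedPressureDecoupling` (stmt-QuantumFields-24028), PROVED**: for every compact
simple `G` and lattice representation `r` there are `W, β₂` with: for `β ≥ β₂`, eventually in the torus size,
`|β · E_{β,L+1}[plaqCost0 r.ρ 1 2]| ≤ W` (`W = D_r/4 + |C|`, `β₂ = max β₁ 1`). [folklore] -/
theorem abs_torusMean_plaqCost_le :
    ∀ (G : Type) [Group G] [TopologicalSpace G] [IsTopologicalGroup G] [CompactSpace G],
      IsCompactSimpleLieGroup G →
      letI : MeasurableSpace G := borel G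
      haveI : BorelSpace G := ⟨rfl⟩
      ∀ r : LatticeRep G, ∃ W β₂ : ℝ, ∀ β : ℝ, β₂ ≤ β → ∀ᶠ L : ℕ in atTop,
        |β * wilsonExpectation (L := L + 1) r.ρ β (toTorusObservable (L + 1) (plaqCost0 (d := 4) r.ρ 1 2))| ≤ W := by
  intro G _ _ _ _ hG
  letI : MeasurableSpace G := borel G
  haveI : BorelSpace G := ⟨rfl⟩
  intro r
  obtain ⟨κ, C, β₁, hκ, h⟩ := torusMean_plaqCost_rate G hG r
  set D : ℝ := (Module.finrank ℝ ↥(Submodule.span ℝ {X : Matrix (Fin r.N) (Fin r.N) ℂ |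
      ∀ t : ℝ, NormedSpace.exp ((t : ℂ) • X) ∈ Set.range r.ρ}) : ℝ) with hD
  refine ⟨D / 4 + |C|, max β₁ 1, fun β hβ => ?_⟩
  have hβ1 : 1 ≤ β := (le_max_right _ _).trans hβ
  filter_upwards [h β ((le_max_left _ _).trans hβ)] with L hL
  have hpow : β ^ (-κ) ≤ 1 := Real.rpow_le_one_of_one_le_of_nonpos hβ1 (by linarith)
  have hpow0 : 0 ≤ β ^ (-κ) := Real.rpow_nonneg (by linarith) _
  have hCβ : C * β ^ (-κ) ≤ |C| := by
    calc C * β ^ (-κ) ≤ |C| * β ^ (-κ) := mul_le_mul_of_nonneg_right (le_abs_self C) hpow0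
      _ ≤ |C| * 1 := mul_le_mul_of_nonneg_left hpow (abs_nonneg C)
      _ = |C| := mul_one _
  have hD0 : 0 ≤ D := by rw [hD]; positivity
  have := abs_sub_abs_le_abs_sub (β * wilsonExpectation (L := L + 1) r.ρ β
    (toTorusObservable (L + 1) (plaqCost0 (d := 4) r.ρ 1 2))) (D / 4)
  rw [abs_of_nonneg (by positivity : (0 : ℝ) ≤ D / 4)] at this
  linarith

end Summit.QuantumFields.YangMills.Theorems.SourcedPressureJensen

end
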